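/-
Copyright (c) 2026 the pub-hodgecm-mathlib formalisation cell (harness21).  Prover seat hodgecm-mathlib-K2E1-p12 (g4) (free E1 analytic hand spilled to S8 per LEAD #21),
Track B ∕ K2-LIT, h413 = `stmt-HodgeConjecture-24833`, R90-TF section S8 «ContSpec-n½», deal S8-R68 (2) (2026-09-04T22:47:59Z; census `R90/S8/CENSUS-MidAtomCusp.K2E1-p12-g4.md`
ac0406556b876efe): the `(L²_cusp)ᗮ` HALF of sub-socket (R) «OF LETTERS» — the middle-pole residue generators of the `φ_ξ`-block are orthogonal to `L²_cusp`, keyed to K2E1-p11's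
★ p862741 `resGMidBlock_le_residualSubspace_of_gen` (`hcusp` bytes), modulo the χ-pair middle-pole letters of the spherical road ★ `K2E1SphericalEisensteinResidueOrthogonalCMThree`.
-/
import Summits.HodgeConjecture.HodgeConjecture.Theorems.R90S8ResGMidBlockLeResidualOfAtomsU3       -- ★ p862741 (K2E1-p11): `resGMidAtom_le_of_gen_subset`, (R)-interface; brings ★ `R90S8ResGMidAtomU3Defs` (`resGMidAtomGen∕Atom∕Block`, `resGMidBlock_le`), ★ `residualSubspace`, ★ `cuspidalSubspace`
import Summits.HodgeConjecture.HodgeConjecture.Theorems.K2E1SphericalEisensteinResidueOrthogonalU      -- ★ (K2E4-p10) generic §1: `inner_eq_zero_of_tendsto`, `inner_eq_zero_of_differentiableOn` (identity principle for `z ↦ ⟪w, F z⟫`)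
import HarnessLib

/-!
# S8 #2 road (G side), sub-socket (R), the `(L²_cusp)ᗮ` half «OF LETTERS» — `R90S8ResGMidAtomOrthogonalCuspidalU3`: the middle-pole residue generators ∕ atoms ∕ block of the
# `φ_ξ`-block on `U_{L∕L⁺}(3)` are ORTHOGONAL TO `L²_cusp`, modulo the χ-pair middle-pole letters (tube seed, truncated residue family, Siegel-top correction)

Track B ∕ K2-LIT, crux h413 = `stmt-HodgeConjecture-24833`, route of record `HCCMUnconditional`; cell `hodgecm-mathlib`, R90-TF programme, section S8 «ContSpec-n½», socket #2 ∕ #3 via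
B ED. 5's sub-socket (R) `sock_S8_res_midBlock_le_residual` («`resGMidBlock ξ μω ≤ residualSubspace (quasiSplit …) μ 𝔓`», S8-R68).  THEOREMS ONLY (no `def`, no `instance`, no
`notation`, no named-fact hypothesis, no `sorry`; default heartbeats); lane `--supports stmt-HodgeConjecture-24833 --as helper` (count-neutral).  CLOSES NO SOCKET: ★ p862741
`resGMidBlock_le_residualSubspace_of_gen` splits (R) into per-level, per-GENERATOR letters `hdisc` («`f ∈ L²_disc`») and `hcusp` («`⟪u, f⟫ = 0` for every `u ∈ L²_cusp`»); THIS FILE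
pays the BYTES of `hcusp` (§4) modulo the honest analytic letters (a)–(d) below, exactly as the spherical top-pole road ★ `K2E1SphericalEisensteinResidueOrthogonalCMThree` §2 pays its
`horth` modulo the operator road's letters.

THE MATHEMATICS ([MoeglinWaldspurger1995, IV.1.11 with II.1.8, I.2.13; V.3.13]; [Rogawski1990, §13.9 p. 229 (ii)]; [BernsteinLapid2019, §4 Claim 2]).  A generator `f` of the middle-pole
residue atom (★ D1 `resGMidAtomGen`: `f =ᵐ x ↦ Fp((out x)⁻¹)(3∕2)`, `Fp g = (z − 3∕2)·Ec z g` near `3∕2`, `Ec` THE continuation of `z ↦ E(φ_z)`) is the residue CLASS at `z₀ = 3∕2` of the Eisenstein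
family of a pair section `φ` of the `φ_ξ`-block.  `E(φ_z) ∉ L²` on the Godement tube `2 < Re z`, so the pairing with a cusp form `φ̂` must go through the TRUNCATED family: an `L²`-valued
holomorphic `F : D → L²` with `F z =ᵐ Λ^T Ẽ(z)` (the operator road; T-hr2-2), whose pairing `z ↦ ⟪φ̂, F z⟫` VANISHES ON THE TUBE (the χ-pair tube seed: the split `Λ^T E(φ_z) = E(𝟙_{H≤T}φ_z) −
E(𝟙_{H>T}(M(z)φ)H^{2−z})` + ★ FILE A `K2E1BLEisensteinCuspOrthogonalU` «`E(f) ⊥ Λ` when `Λ_B ≡ 0`» twice), hence on all of `D` (identity principle, ★ generic `inner_eq_zero_of_differentiableOn`);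
the residue class is `f = lim_{z → 3∕2} (z − 3∕2)•F z + corr` with `corr = [𝟙_{T<H}·ρ·(M(3∕2)φ)·H^{1∕2}]` the Siegel-top correction (T-hr2-1), itself orthogonal to cusp forms (FILE A on a
Borel-invariant profile supported above the floor); so `⟪φ̂, f⟫ = 0` (★ `inner_eq_zero_of_tendsto`), and `L²_cusp = closure (range cuspFormsToLp)` (★ `cuspidalSubspace`) finishes.

VISIBLE LETTERS (per generator `f`; payers named): (a) the χ-PAIR TUBE SEED `hseed : ∀ z ∈ D, 2 < z.re → ∀ φ, ⟪cuspFormsToLp μ 𝔓 φ, F z⟫ = 0` (new M item: the pair-section twin of ★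
`inner_cuspFormsToLp_eq_zero_of_ae_eq_truncation_cm_three` — needs the POINTWISE pair constant term `f_z + (M(z)φ)·H^{2−z}` of ★ `K2E1ChiEisensteinConstantTermCMThree`'s (S2)χ + the
truncation split + ★ FILE A∕B); (b)+(c) the truncated family `F` on `D` and `hlim : Tendsto ((z − 3∕2)•F z + corr) (𝓝[≠] 3∕2) (𝓝 f)` (T-hr2-2 ∕ T-hr2-1, K2E1-p16 (g2), S8-R72 (3); R90-C133-p02's
`hr2`); (d) `hcorr : ∀ φ, ⟪cuspFormsToLp μ 𝔓 φ, corr⟫ = 0` (FILE A instance, S).  CENSUS FINDING: none of (a)–(d) is ★ at N = 3 for PAIR sections at the MIDDLE pole tonight (the ★ road is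
spherical ∕ top-pole); D1's bare clauses give only the POINTWISE limit `(z − 3∕2)·Ec z g → Fp g (3∕2)`, which cannot be paired with an `L²` cusp form without (b)(c).
* §1 `inner_eq_zero_of_residueFamily` — GENERIC (any complex Hilbert space, any pole `z₀`, with a correction term): seed near `z₁ ∈ D` + identity principle + residue limit.
* §2 `inner_cuspFormsToLp_eq_zero_of_midResidue_letters` — at `U(J₃)`, pole `3∕2`, seed on the tube `{2 < Re} ∩ D` around a real point `σ₀ > 2`.
* §3 `inner_eq_zero_of_mem_cuspidalSubspace_of_forall_cuspFormsToLp` — the CLOSURE STEP, proved: orthogonal to every cusp-form class ⟹ orthogonal to `L²_cusp`.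
* §4 **`resGMidAtomGen_inner_cuspidal_eq_zero_of_letters`** = ★ p862741's `hcusp` BYTES at one level (letters (a)–(d) as one ∃-package per generator); `resGMidAtom_le_orthogonal_cuspidal_of_letters`
  (the atom-level form ★ p862741 §2 also accepts); `resGMidBlock_le_orthogonal_cuspidal_of_letters` (block level, ★ `resGMidBlock_le` at the closed invariant `(L²_cusp)ᗮ` = ★
  `ClosedSubrep.orthogonal`); and the (R) assembly `resGMidBlock_le_residualSubspace_of_disc_of_cuspLetters` (= ★ p862741's interface with `hcusp` discharged by the letters, `hdisc` kept).
HONEST LABEL: HC_CM is proved only modulo the 7 printed citations (2 remaining named inputs: hLiu418 = `stmt-HodgeConjecture-24832`, h413 = `stmt-HodgeConjecture-24833`) until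
rung 0 closes; REL ≠ ★ ≠ BUILT; this file asserts no named fact, is conditional by construction on its visible binders ((a)–(d) per generator; `hdisc`), and closes no socket — (R) stays
OPEN modulo `hdisc` + (a)–(d); count-neutral.

## References
* [MoeglinWaldspurger1995] C. Mœglin, J.-L. Waldspurger, *Spectral Decomposition and Eisenstein Series* (1995), I.2.13, I.2.18, II.1.8, IV.1.11, V.3.13.
* [Rogawski1990] J. D. Rogawski, *Automorphic Representations of Unitary Groups in Three Variables* (1990), §13.9 p. 229 (ii).
* [BernsteinLapid2019] J. Bernstein, E. Lapid, *On the meromorphic continuation of Eisenstein series*, J. AMS (2019), §4 Claim 2.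
* [Conway1978] J. B. Conway, *Functions of One Complex Variable*, 2nd ed. (1978), IV §3 (identity theorem).
-/

set_option autoImplicit false
set_option linter.dupNamespace false  -- the mandated namespace `…HodgeConjecture.HodgeConjecture.R90.S8` (LEAD #1 L1) repeats the summit's segment

noncomputable section

open MeasureTheory Measure Set Filter Topology NumberField ContRepresentation
open Literature.NumberTheory.Automorphic Literature.NumberTheory.Automorphic.UnitaryGroup Literature.NumberTheory.GaloisRepresentations AdelicGroupData
open Literature.NumberTheory.Rogawski1990
open Summit.HodgeConjecture.HodgeConjecture.Cruxes.H413.K2E1CuspidalSpectrumUnitary (residualSubspace)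
open Summit.HodgeConjecture.HodgeConjecture.Cruxes.H413.K2E1SphericalEisensteinResidueOrthogonalU (inner_eq_zero_of_tendsto inner_eq_zero_of_differentiableOn)
open scoped ENNReal NNReal InnerProductSpace

namespace Summit.HodgeConjecture.HodgeConjecture.R90.S8

/-! ## §1 Generic: seed + identity principle + residue limit with a correction term ⟹ the residue class is orthogonal to `w` -/

section Hilbert

variable {H : Type*} [NormedAddCommGroup H] [InnerProductSpace ℂ H]

/-- **THE RESIDUE-FAMILY ARGUMENT, ANY HILBERT SPACE, ANY POLE `z₀`**: let `F : ℂ → H` be holomorphic on an open preconnected `D` which contains a punctured neighbourhood of `z₀`; if `⟪w, F z⟫ = 0`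
for `z` near some `z₁ ∈ D` (the seed), then `⟪w, F z⟫ = 0` on `D` (★ `inner_eq_zero_of_differentiableOn`), so `⟪w, (z − z₀)•F z + corr⟫ = ⟪w, corr⟫ = 0` near `z₀`, and the limit
`v = lim_{z → z₀, z ≠ z₀} (z − z₀)•F z + corr` is orthogonal to `w` (★ `inner_eq_zero_of_tendsto`).  The spherical head's steps (2)(4)(5), abstracted. [cite: Conway1978, IV §3] [cite: MoeglinWaldspurger1995, IV.1.11] -/
theorem inner_eq_zero_of_residueFamily {F : ℂ → H} {D : Set ℂ} (hDo : IsOpen D) (hDc : IsPreconnected D) (hFd : DifferentiableOn ℂ F D)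
    (w : H) {z₁ : ℂ} (hz₁ : z₁ ∈ D) (hseed : ∀ᶠ z in 𝓝 z₁, ⟪w, F z⟫_ℂ = 0)
    {z₀ : ℂ} (hD0 : ∀ᶠ z in 𝓝[≠] z₀, z ∈ D) {v corr : H}
    (hlim : Tendsto (fun z : ℂ => (z - z₀) • F z + corr) (𝓝[≠] z₀) (𝓝 v)) (hcorr : ⟪w, corr⟫_ℂ = 0) : ⟪w, v⟫_ℂ = 0 := by
  have hD : ∀ z ∈ D, ⟪w, F z⟫_ℂ = 0 := inner_eq_zero_of_differentiableOn hDo hDc hFd w hz₁ hseed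
  have h0 : ∀ᶠ z in 𝓝[≠] z₀, ⟪w, (z - z₀) • F z + corr⟫_ℂ = 0 := by
    filter_upwards [hD0] with z hz
    rw [inner_add_right, inner_smul_right, hD z hz, hcorr, mul_zero, zero_add]
  exact inner_eq_zero_of_tendsto w hlim h0

/-- The same WITHOUT a correction term (`corr = 0`). [cite: Conway1978, IV §3] -/
theorem inner_eq_zero_of_residueFamily₀ {F : ℂ → H} {D : Set ℂ} (hDo : IsOpen D) (hDc : IsPreconnected D) (hFd : DifferentiableOn ℂ F D)
    (w : H) {z₁ : ℂ} (hz₁ : z₁ ∈ D) (hseed : ∀ᶠ z in 𝓝 z₁, ⟪w, F z⟫_ℂ = 0)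
    {z₀ : ℂ} (hD0 : ∀ᶠ z in 𝓝[≠] z₀, z ∈ D) {v : H}
    (hlim : Tendsto (fun z : ℂ => (z - z₀) • F z) (𝓝[≠] z₀) (𝓝 v)) : ⟪w, v⟫_ℂ = 0 :=
  inner_eq_zero_of_residueFamily hDo hDc hFd w hz₁ hseed hD0 (corr := 0) (by simpa only [add_zero] using hlim) (inner_zero_right _)

/-- **THE CLOSURE STEP, ANY HILBERT SPACE**: a vector orthogonal to a submodule `K` is orthogonal to its topological closure (`closure K ≤ Kᗮᗮ`, ★ Mathlib `Submodule.le_orthogonal_orthogonal` +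
`Submodule.isClosed_orthogonal`). [folklore] -/
theorem inner_eq_zero_of_mem_topologicalClosure_of_forall {K : Submodule ℂ H} {v : H} (h : ∀ u ∈ K, ⟪u, v⟫_ℂ = 0) :
    ∀ u ∈ K.topologicalClosure, ⟪u, v⟫_ℂ = 0 := by
  intro u hu
  have hv : v ∈ Kᗮ := (Submodule.mem_orthogonal K v).2 h
  have hcl : K.topologicalClosure ≤ Kᗮᗮ := Submodule.topologicalClosure_minimal _ (Submodule.le_orthogonal_orthogonal K) (Submodule.isClosed_orthogonal _)
  exact Submodule.inner_left_of_mem_orthogonal hv (hcl hu)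

end Hilbert

/-! ## §2 At `U(J₃) = quasiSplit L⁺ L c 3`, pole `3∕2`: the residue class of a truncated Eisenstein family with a tube seed is orthogonal to every cusp form -/

section Print

variable (L : Type) [Field L] [NumberField L] [IsCMField L]
  (μ : Measure (quasiSplit (↥(maximalRealSubfield L)) L (IsCMField.complexConj L) 3).automorphicQuotient)
  [(quasiSplit (↥(maximalRealSubfield L)) L (IsCMField.complexConj L) 3).IsAutomorphicMeasure μ]
  (𝔓 : (quasiSplit (↥(maximalRealSubfield L)) L (IsCMField.complexConj L) 3).ParabolicUnipotentData)

omit [(quasiSplit (↥(maximalRealSubfield L)) L (IsCMField.complexConj L) 3).IsAutomorphicMeasure μ] in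
/-- **`⟪φ̂, f⟫ = 0` FOR EVERY CUSP FORM, MODULO THE MIDDLE-POLE LETTERS**: `F : ℂ → L²(μ)` holomorphic on an open preconnected `D` containing a neighbourhood of a real tube point `σ₀ > 2` and a
punctured neighbourhood of `3∕2`; (a) TUBE SEED `hseed` (`⟪φ̂, F z⟫ = 0` for `z ∈ D`, `2 < Re z` — the truncated pair family pairs to zero with cusp forms); (b)(c) RESIDUE LETTER `hlim`
(`(z − 3∕2)•F z + corr → f`); (d) `hcorr` (the Siegel-top correction is orthogonal to cusp forms) ⟹ `⟪cuspFormsToLp φ, f⟫ = 0` for every continuous square-integrable cusp form `φ`.  §1 with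
the seed propagated from the open set `{2 < Re} ∩ D ∋ σ₀`. [cite: MoeglinWaldspurger1995, IV.1.11, II.1.8] [cite: BernsteinLapid2019, §4 Claim 2] [cite: Rogawski1990, §13.9 p. 229 (ii)] -/
theorem inner_cuspFormsToLp_eq_zero_of_midResidue_letters
    (F : ℂ → (quasiSplit (↥(maximalRealSubfield L)) L (IsCMField.complexConj L) 3).L2 μ) {D : Set ℂ} (hDo : IsOpen D) (hDc : IsPreconnected D) (hFd : DifferentiableOn ℂ F D)
    {σ₀ : ℝ} (hσ₀ : 2 < σ₀) (hσD : ∀ᶠ z in 𝓝 ((σ₀ : ℝ) : ℂ), z ∈ D) (hD32 : ∀ᶠ z in 𝓝[≠] ((3 : ℂ) / 2), z ∈ D)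
    (hseed : ∀ z ∈ D, 2 < z.re → ∀ φ : ↥((quasiSplit (↥(maximalRealSubfield L)) L (IsCMField.complexConj L) 3).cuspForms μ 𝔓),
      ⟪(quasiSplit (↥(maximalRealSubfield L)) L (IsCMField.complexConj L) 3).cuspFormsToLp μ 𝔓 φ, F z⟫_ℂ = 0)
    (f corr : (quasiSplit (↥(maximalRealSubfield L)) L (IsCMField.complexConj L) 3).L2 μ)
    (hlim : Tendsto (fun z : ℂ => (z - (3 : ℂ) / 2) • F z + corr) (𝓝[≠] ((3 : ℂ) / 2)) (𝓝 f))
    (hcorr : ∀ φ : ↥((quasiSplit (↥(maximalRealSubfield L)) L (IsCMField.complexConj L) 3).cuspForms μ 𝔓),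
      ⟪(quasiSplit (↥(maximalRealSubfield L)) L (IsCMField.complexConj L) 3).cuspFormsToLp μ 𝔓 φ, corr⟫_ℂ = 0) :
    ∀ φ : ↥((quasiSplit (↥(maximalRealSubfield L)) L (IsCMField.complexConj L) 3).cuspForms μ 𝔓),
      ⟪(quasiSplit (↥(maximalRealSubfield L)) L (IsCMField.complexConj L) 3).cuspFormsToLp μ 𝔓 φ, f⟫_ℂ = 0 := by
  intro φ
  -- the seed near the real tube point `σ₀`: `D ∩ {2 < Re}` is a neighbourhood of `σ₀`
  obtain ⟨ε, hε, hball⟩ := Metric.eventually_nhds_iff_ball.1 hσD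
  have hσ₀D : ((σ₀ : ℝ) : ℂ) ∈ D := hball _ (Metric.mem_ball_self hε)
  have htube : ∀ᶠ z in 𝓝 ((σ₀ : ℝ) : ℂ), 2 < z.re :=
    (Complex.continuous_re.isOpen_preimage _ isOpen_Ioi).mem_nhds (by simpa only [mem_preimage, Complex.ofReal_re, mem_Ioi] using hσ₀)
  have hseed' : ∀ᶠ z in 𝓝 ((σ₀ : ℝ) : ℂ), ⟪(quasiSplit (↥(maximalRealSubfield L)) L (IsCMField.complexConj L) 3).cuspFormsToLp μ 𝔓 φ, F z⟫_ℂ = 0 := by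
    filter_upwards [hσD, htube] with z hz hz2
    exact hseed z hz hz2 φ
  exact inner_eq_zero_of_residueFamily hDo hDc hFd _ hσ₀D hseed' hD32 hlim (hcorr φ)

/-! ## §3 The closure step at `U(J₃)`: orthogonal to every cusp-form class ⟹ orthogonal to `L²_cusp = closure (range cuspFormsToLp)` -/

/-- **`⟪u, f⟫ = 0` FOR EVERY `u ∈ L²_cusp`** as soon as `⟪φ̂, f⟫ = 0` for every continuous square-integrable cusp form `φ` (★ `cuspidalSubspace μ 𝔓 = (range (cuspFormsToLp μ 𝔓)).topologicalClosure`,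
★ `toSubmodule_cuspidalSubspace`; §1 closure step) — the bytes of ★ p862741's `hcusp` for ONE class `f`. [cite: BorelJacquet1979, §4.4–4.6] [cite: MoeglinWaldspurger1995, I.2.18] -/
theorem inner_eq_zero_of_mem_cuspidalSubspace_of_forall_cuspFormsToLp (f : (quasiSplit (↥(maximalRealSubfield L)) L (IsCMField.complexConj L) 3).L2 μ)
    (h : ∀ φ : ↥((quasiSplit (↥(maximalRealSubfield L)) L (IsCMField.complexConj L) 3).cuspForms μ 𝔓),
      ⟪(quasiSplit (↥(maximalRealSubfield L)) L (IsCMField.complexConj L) 3).cuspFormsToLp μ 𝔓 φ, f⟫_ℂ = 0) :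
    ∀ u ∈ (quasiSplit (↥(maximalRealSubfield L)) L (IsCMField.complexConj L) 3).cuspidalSubspace μ 𝔓,
      ⟪(u : (quasiSplit (↥(maximalRealSubfield L)) L (IsCMField.complexConj L) 3).L2 μ), f⟫_ℂ = 0 := by
  intro u hu
  have hu' : u ∈ (LinearMap.range ((quasiSplit (↥(maximalRealSubfield L)) L (IsCMField.complexConj L) 3).cuspFormsToLp μ 𝔓)).topologicalClosure := by
    have h1 : u ∈ ((quasiSplit (↥(maximalRealSubfield L)) L (IsCMField.complexConj L) 3).cuspidalSubspace μ 𝔓).toSubmodule := hu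
    rwa [AdelicGroupData.toSubmodule_cuspidalSubspace] at h1
  refine inner_eq_zero_of_mem_topologicalClosure_of_forall (fun u' hu'' => ?_) u hu'
  obtain ⟨φ, rfl⟩ := LinearMap.mem_range.1 hu''
  exact h φ

/-! ## §4 The `hcusp` letter of ★ p862741 «of letters»: generators ∕ atoms ∕ the block of record are orthogonal to `L²_cusp` -/

variable (ξ : OneDimAutRepH L) (μω : HeckeCharacter L)
  (K' : Subgroup (quasiSplit (↥(maximalRealSubfield L)) L (IsCMField.complexConj L) 3).Adelic) (ω : ↥K' →* ℂ)

/-- **★ p862741's `hcusp` BYTES AT ONE LEVEL `(K′, ω)`, MODULO THE MIDDLE-POLE LETTERS**: if every generator `f` of the middle-pole residue atom of `ξ` at level `(K′, ω)` comes with the χ-pair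
middle-pole package — a truncated Eisenstein `L²`-family `F` on an open preconnected `D ∋ σ₀ > 2` reaching a punctured neighbourhood of `3∕2`, its TUBE SEED (a), the RESIDUE LETTER (b)(c)
`(z − 3∕2)•F z + corr → f` and the correction's cusp-orthogonality (d) — then `⟪u, f⟫ = 0` for every generator `f` and every `u ∈ L²_cusp(𝔓)`.
[cite: MoeglinWaldspurger1995, IV.1.11, V.3.13] [cite: Rogawski1990, §13.9 p. 229 (ii)] [cite: BernsteinLapid2019, §4 Claim 2] -/
theorem resGMidAtomGen_inner_cuspidal_eq_zero_of_letters
    (hL : ∀ f ∈ resGMidAtomGen L μ ξ μω K' ω,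
      ∃ (F : ℂ → (quasiSplit (↥(maximalRealSubfield L)) L (IsCMField.complexConj L) 3).L2 μ) (D : Set ℂ) (σ₀ : ℝ)
        (corr : (quasiSplit (↥(maximalRealSubfield L)) L (IsCMField.complexConj L) 3).L2 μ),
        IsOpen D ∧ IsPreconnected D ∧ DifferentiableOn ℂ F D ∧ 2 < σ₀ ∧ (∀ᶠ z in 𝓝 ((σ₀ : ℝ) : ℂ), z ∈ D) ∧ (∀ᶠ z in 𝓝[≠] ((3 : ℂ) / 2), z ∈ D) ∧
        (∀ z ∈ D, 2 < z.re → ∀ φ : ↥((quasiSplit (↥(maximalRealSubfield L)) L (IsCMField.complexConj L) 3).cuspForms μ 𝔓),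
          ⟪(quasiSplit (↥(maximalRealSubfield L)) L (IsCMField.complexConj L) 3).cuspFormsToLp μ 𝔓 φ, F z⟫_ℂ = 0) ∧
        Tendsto (fun z : ℂ => (z - (3 : ℂ) / 2) • F z + corr) (𝓝[≠] ((3 : ℂ) / 2)) (𝓝 f) ∧
        ∀ φ : ↥((quasiSplit (↥(maximalRealSubfield L)) L (IsCMField.complexConj L) 3).cuspForms μ 𝔓),
          ⟪(quasiSplit (↥(maximalRealSubfield L)) L (IsCMField.complexConj L) 3).cuspFormsToLp μ 𝔓 φ, corr⟫_ℂ = 0) :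
    ∀ f ∈ resGMidAtomGen L μ ξ μω K' ω, ∀ u ∈ (quasiSplit (↥(maximalRealSubfield L)) L (IsCMField.complexConj L) 3).cuspidalSubspace μ 𝔓,
      ⟪(u : (quasiSplit (↥(maximalRealSubfield L)) L (IsCMField.complexConj L) 3).L2 μ), f⟫_ℂ = 0 := by
  intro f hf
  obtain ⟨F, D, σ₀, corr, hDo, hDc, hFd, hσ₀, hσD, hD32, hseed, hlim, hcorr⟩ := hL f hf
  exact inner_eq_zero_of_mem_cuspidalSubspace_of_forall_cuspFormsToLp L μ 𝔓 f
    (inner_cuspFormsToLp_eq_zero_of_midResidue_letters L μ 𝔓 F hDo hDc hFd hσ₀ hσD hD32 hseed f corr hlim hcorr)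

/-- **ATOM LEVEL**: under the same per-generator package, `resGMidAtom ξ μω K′ ω ≤ (L²_cusp)ᗮ` (the atom is the closed span of the generators and `(L²_cusp)ᗮ` is closed — ★ p862741
`resGMidAtom_le_of_gen_subset`). [cite: MoeglinWaldspurger1995, V.3.13] -/
theorem resGMidAtom_le_orthogonal_cuspidal_of_letters
    (hL : ∀ f ∈ resGMidAtomGen L μ ξ μω K' ω,
      ∃ (F : ℂ → (quasiSplit (↥(maximalRealSubfield L)) L (IsCMField.complexConj L) 3).L2 μ) (D : Set ℂ) (σ₀ : ℝ)
        (corr : (quasiSplit (↥(maximalRealSubfield L)) L (IsCMField.complexConj L) 3).L2 μ),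
        IsOpen D ∧ IsPreconnected D ∧ DifferentiableOn ℂ F D ∧ 2 < σ₀ ∧ (∀ᶠ z in 𝓝 ((σ₀ : ℝ) : ℂ), z ∈ D) ∧ (∀ᶠ z in 𝓝[≠] ((3 : ℂ) / 2), z ∈ D) ∧
        (∀ z ∈ D, 2 < z.re → ∀ φ : ↥((quasiSplit (↥(maximalRealSubfield L)) L (IsCMField.complexConj L) 3).cuspForms μ 𝔓),
          ⟪(quasiSplit (↥(maximalRealSubfield L)) L (IsCMField.complexConj L) 3).cuspFormsToLp μ 𝔓 φ, F z⟫_ℂ = 0) ∧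
        Tendsto (fun z : ℂ => (z - (3 : ℂ) / 2) • F z + corr) (𝓝[≠] ((3 : ℂ) / 2)) (𝓝 f) ∧
        ∀ φ : ↥((quasiSplit (↥(maximalRealSubfield L)) L (IsCMField.complexConj L) 3).cuspForms μ 𝔓),
          ⟪(quasiSplit (↥(maximalRealSubfield L)) L (IsCMField.complexConj L) 3).cuspFormsToLp μ 𝔓 φ, corr⟫_ℂ = 0) :
    resGMidAtom L μ ξ μω K' ω ≤ ((quasiSplit (↥(maximalRealSubfield L)) L (IsCMField.complexConj L) 3).cuspidalSubspace μ 𝔓).toSubmoduleᗮ :=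
  resGMidAtom_le_of_gen_subset L μ ξ μω K' ω _ (Submodule.isClosed_orthogonal _) fun f hf =>
    (Submodule.mem_orthogonal _ f).2 fun u hu => resGMidAtomGen_inner_cuspidal_eq_zero_of_letters L μ 𝔓 ξ μω K' ω hL f hf u hu

/-- **BLOCK LEVEL**: if EVERY level's generators carry the package, the middle block of record `resGMidBlock ξ μω` lies in `(L²_cusp)ᗮ` — `(L²_cusp)ᗮ` is a CLOSED INVARIANT subspace of the
unitary regular representation (★ `ClosedSubrep.orthogonal`), so ★ `resGMidBlock_le` (minimality of the hull) applies. [cite: MoeglinWaldspurger1995, I.2.18, V.3.13] -/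
theorem resGMidBlock_le_orthogonal_cuspidal_of_letters
    (hL : ∀ (K' : Subgroup (quasiSplit (↥(maximalRealSubfield L)) L (IsCMField.complexConj L) 3).Adelic) (ω : ↥K' →* ℂ), ∀ f ∈ resGMidAtomGen L μ ξ μω K' ω,
      ∃ (F : ℂ → (quasiSplit (↥(maximalRealSubfield L)) L (IsCMField.complexConj L) 3).L2 μ) (D : Set ℂ) (σ₀ : ℝ)
        (corr : (quasiSplit (↥(maximalRealSubfield L)) L (IsCMField.complexConj L) 3).L2 μ),
        IsOpen D ∧ IsPreconnected D ∧ DifferentiableOn ℂ F D ∧ 2 < σ₀ ∧ (∀ᶠ z in 𝓝 ((σ₀ : ℝ) : ℂ), z ∈ D) ∧ (∀ᶠ z in 𝓝[≠] ((3 : ℂ) / 2), z ∈ D) ∧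
        (∀ z ∈ D, 2 < z.re → ∀ φ : ↥((quasiSplit (↥(maximalRealSubfield L)) L (IsCMField.complexConj L) 3).cuspForms μ 𝔓),
          ⟪(quasiSplit (↥(maximalRealSubfield L)) L (IsCMField.complexConj L) 3).cuspFormsToLp μ 𝔓 φ, F z⟫_ℂ = 0) ∧
        Tendsto (fun z : ℂ => (z - (3 : ℂ) / 2) • F z + corr) (𝓝[≠] ((3 : ℂ) / 2)) (𝓝 f) ∧
        ∀ φ : ↥((quasiSplit (↥(maximalRealSubfield L)) L (IsCMField.complexConj L) 3).cuspForms μ 𝔓),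
          ⟪(quasiSplit (↥(maximalRealSubfield L)) L (IsCMField.complexConj L) 3).cuspFormsToLp μ 𝔓 φ, corr⟫_ℂ = 0) :
    (resGMidBlock L μ ξ μω).toSubmodule ≤ ((quasiSplit (↥(maximalRealSubfield L)) L (IsCMField.complexConj L) 3).cuspidalSubspace μ 𝔓).toSubmoduleᗮ :=
  resGMidBlock_le L μ ξ μω
    (((quasiSplit (↥(maximalRealSubfield L)) L (IsCMField.complexConj L) 3).cuspidalSubspace μ 𝔓).orthogonal
      ((quasiSplit (↥(maximalRealSubfield L)) L (IsCMField.complexConj L) 3).isUnitary_rightRegular μ))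
    fun K' ω => resGMidAtom_le_orthogonal_cuspidal_of_letters L μ 𝔓 ξ μω K' ω (hL K' ω)

/-- **(R) ASSEMBLY with the cusp half discharged by the letters**: ★ p862741's interface `resGMidBlock_le_residualSubspace_of_disc_of_orth` with `hcusp` supplied by §4 — what remains of (R)
is the `L²_disc` half `hdisc` (finite length of the residual block) and the middle-pole letters (a)–(d). [cite: MoeglinWaldspurger1995, I.2.18, V.3.13] [cite: Rogawski1990, §13.9 p. 229 (ii)] -/
theorem resGMidBlock_le_residualSubspace_of_disc_of_cuspLetters
    (hdisc : ∀ (K' : Subgroup (quasiSplit (↥(maximalRealSubfield L)) L (IsCMField.complexConj L) 3).Adelic) (ω : ↥K' →* ℂ),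
      resGMidAtom L μ ξ μω K' ω ≤ ((quasiSplit (↥(maximalRealSubfield L)) L (IsCMField.complexConj L) 3).discreteSpectrum μ).toSubmodule)
    (hL : ∀ (K' : Subgroup (quasiSplit (↥(maximalRealSubfield L)) L (IsCMField.complexConj L) 3).Adelic) (ω : ↥K' →* ℂ), ∀ f ∈ resGMidAtomGen L μ ξ μω K' ω,
      ∃ (F : ℂ → (quasiSplit (↥(maximalRealSubfield L)) L (IsCMField.complexConj L) 3).L2 μ) (D : Set ℂ) (σ₀ : ℝ)
        (corr : (quasiSplit (↥(maximalRealSubfield L)) L (IsCMField.complexConj L) 3).L2 μ),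
        IsOpen D ∧ IsPreconnected D ∧ DifferentiableOn ℂ F D ∧ 2 < σ₀ ∧ (∀ᶠ z in 𝓝 ((σ₀ : ℝ) : ℂ), z ∈ D) ∧ (∀ᶠ z in 𝓝[≠] ((3 : ℂ) / 2), z ∈ D) ∧
        (∀ z ∈ D, 2 < z.re → ∀ φ : ↥((quasiSplit (↥(maximalRealSubfield L)) L (IsCMField.complexConj L) 3).cuspForms μ 𝔓),
          ⟪(quasiSplit (↥(maximalRealSubfield L)) L (IsCMField.complexConj L) 3).cuspFormsToLp μ 𝔓 φ, F z⟫_ℂ = 0) ∧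
        Tendsto (fun z : ℂ => (z - (3 : ℂ) / 2) • F z + corr) (𝓝[≠] ((3 : ℂ) / 2)) (𝓝 f) ∧
        ∀ φ : ↥((quasiSplit (↥(maximalRealSubfield L)) L (IsCMField.complexConj L) 3).cuspForms μ 𝔓),
          ⟪(quasiSplit (↥(maximalRealSubfield L)) L (IsCMField.complexConj L) 3).cuspFormsToLp μ 𝔓 φ, corr⟫_ℂ = 0) :
    resGMidBlock L μ ξ μω ≤ residualSubspace (quasiSplit (↥(maximalRealSubfield L)) L (IsCMField.complexConj L) 3) μ 𝔓 :=
  resGMidBlock_le_residualSubspace_of_disc_of_orth L μ ξ μω 𝔓 hdisc fun K' ω => resGMidAtom_le_orthogonal_cuspidal_of_letters L μ 𝔓 ξ μω K' ω (hL K' ω)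

end Print

end Summit.HodgeConjecture.HodgeConjecture.R90.S8

end
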